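import Mathlib
import Summits.ValiantsHypothesis.ValiantsHypothesis.Theorems.NewtonUnitEquationsTwoProductsRaySeries
import Summits.ValiantsHypothesis.ValiantsHypothesis.Theorems.NewtonUnitEquationsTwoProductsPowerSumCriterion
/-! # Rung `stub_engineRayFactors` — crux `TwoProducts` (stmt-ValiantsHypothesis-5906), line `corner-log-linearization`
   RAY FACTORS (the `t`-free backbone of the binomial rung).  If every factor `u_i`, `v_i` is a univariate
   polynomial in ONE monomial — its support lies on a ray `ℕ • g_i` (resp. `ℕ • g'_i`) through the origin, with no
   bound on the number of monomials — then every power `(u_i − 1)^r` is supported on the same ray, so the truncated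
   log series `Λ_R = Σ_{r=1}^{R} ((−1)^{r+1}/r) • (Σ_i (u_i − 1)^r − Σ_i (v_i − 1)^r)` is supported on the `≤ 2n`
   rays, and (landed `RaySeries.ncard_le_of_rays`: two stable unique minimisers on one ray are impossible) the set
   of stable south-west log vertices has at most `2n` elements.  With constant terms `1` the landed power-sum
   criterion turns this into `#swVert(∏ u − ∏ v) ≤ 2n`, uniformly in the sparsity `t` and in all degrees: the
   sparsity hypothesis `t ≤ 2` of `stub_raySeries` is replaced by the support hypothesis alone.  (In the log /
   Puiseux-row picture this is "level 0": rows of `log u_i` of a ray factor sit on the ray, one vertex per ray.)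
   [folklore] -/
set_option linter.dupNamespace false -- single-conjunct summit: `ValiantsHypothesis.ValiantsHypothesis`
namespace Summit.ValiantsHypothesis.ValiantsHypothesis.Theorems.TwoProducts.RayFactors
open scoped BigOperators
open MvPolynomial
open Summit.ValiantsHypothesis.ValiantsHypothesis.Theorems.TwoProducts.RaySeries (ncard_le_of_rays)

/-! "Supported on the ray `ℕ • g`" is written inline as `∀ e ∈ p.support, ∃ k : ℕ, e = k • g` (no new definition). -/

/-- `1` is supported on every ray (`0 = 0 • g`). [folklore] -/
theorem onRay_one (g : Fin 2 →₀ ℕ) : ∀ e ∈ (1 : MvPolynomial (Fin 2) ℂ).support, ∃ k : ℕ, e = k • g := by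
  intro e he
  rw [support_one, Finset.mem_singleton] at he
  exact ⟨0, by rw [he, zero_smul]⟩

/-- Rays are closed under subtraction of polynomials. [folklore] -/
theorem onRay_sub {g : Fin 2 →₀ ℕ} {p q : MvPolynomial (Fin 2) ℂ} (hp : ∀ e ∈ p.support, ∃ k : ℕ, e = k • g)
    (hq : ∀ e ∈ q.support, ∃ k : ℕ, e = k • g) : ∀ e ∈ (p - q).support, ∃ k : ℕ, e = k • g := by
  intro e he
  classical
  rcases Finset.mem_union.mp (support_sub (σ := Fin 2) p q he) with h | h
  · exact hp e h
  · exact hq e h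

/-- Rays are closed under products of polynomials. [folklore] -/
theorem onRay_mul {g : Fin 2 →₀ ℕ} {p q : MvPolynomial (Fin 2) ℂ} (hp : ∀ e ∈ p.support, ∃ k : ℕ, e = k • g)
    (hq : ∀ e ∈ q.support, ∃ k : ℕ, e = k • g) : ∀ e ∈ (p * q).support, ∃ k : ℕ, e = k • g := by
  intro e he
  classical
  obtain ⟨a, ha, b, hb, rfl⟩ := Finset.mem_add.mp (support_mul p q he)
  obtain ⟨k, rfl⟩ := hp a ha
  obtain ⟨l, rfl⟩ := hq b hb
  exact ⟨k + l, by rw [add_smul]⟩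

/-- Rays are closed under powers. [folklore] -/
theorem onRay_pow {g : Fin 2 →₀ ℕ} {p : MvPolynomial (Fin 2) ℂ} (hp : ∀ e ∈ p.support, ∃ k : ℕ, e = k • g)
    (r : ℕ) : ∀ e ∈ (p ^ r).support, ∃ k : ℕ, e = k • g := by
  induction r with
  | zero => rw [pow_zero]; exact onRay_one g
  | succ r ih => rw [pow_succ]; exact onRay_mul ih hp

/-- Support confinement: for ray factors every exponent of the truncated log series lies on one of the `2n`
rays. [folklore] -/
theorem mem_ray_of_mem_support {n : ℕ} (u v : Fin n → MvPolynomial (Fin 2) ℂ) (g g' : Fin n → Fin 2 →₀ ℕ)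
    (hu : ∀ i, ∀ e ∈ (u i).support, ∃ k : ℕ, e = k • g i) (hv : ∀ i, ∀ e ∈ (v i).support, ∃ k : ℕ, e = k • g' i)
    (R : ℕ) (e : Fin 2 →₀ ℕ)
    (he : e ∈ (∑ r ∈ Finset.Icc 1 R, ((-1 : ℂ) ^ (r + 1) / (r : ℂ)) •
            (∑ i, (u i - 1) ^ r - ∑ i, (v i - 1) ^ r)).support) :
    (∃ (i : Fin n) (r : ℕ), e = r • g i) ∨ (∃ (i : Fin n) (r : ℕ), e = r • g' i) := by
  classical
  obtain ⟨r, -, hr⟩ := Finset.mem_biUnion.mp (support_sum he)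
  have hr' := support_smul hr
  rcases Finset.mem_union.mp (support_sub (σ := Fin 2) _ _ hr') with h | h
  · obtain ⟨i, -, hi⟩ := Finset.mem_biUnion.mp (support_sum h)
    obtain ⟨k, hk⟩ := onRay_pow (onRay_sub (hu i) (onRay_one (g i))) r e hi
    exact Or.inl ⟨i, k, hk⟩
  · obtain ⟨i, -, hi⟩ := Finset.mem_biUnion.mp (support_sum h)
    obtain ⟨k, hk⟩ := onRay_pow (onRay_sub (hv i) (onRay_one (g' i))) r e hi
    exact Or.inr ⟨i, k, hk⟩

/-- RUNG `stub_engineRayFactors` (registered vocabulary): if the support of every factor lies on a ray through the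
origin, the set of stable south-west vertices of the truncated log series has at most `2n` elements — whatever the
number of monomials and the degrees. [folklore] -/
theorem stub_engineRayFactors : ∀ (n : ℕ) (u v : Fin n → MvPolynomial (Fin 2) ℂ),
    (∀ i, ∃ g : Fin 2 →₀ ℕ, ∀ e ∈ (u i).support, ∃ k : ℕ, e = k • g) →
    (∀ i, ∃ g : Fin 2 →₀ ℕ, ∀ e ∈ (v i).support, ∃ k : ℕ, e = k • g) →
    {e : Fin 2 →₀ ℕ | ∃ w : Fin 2 → ℤ, 0 < w 0 ∧ 0 < w 1 ∧ ∀ R : ℕ, w 0 * (e 0 : ℤ) + w 1 * (e 1 : ℤ) < (R : ℤ) →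
      (e ∈ (∑ r ∈ Finset.Icc 1 R, ((-1 : ℂ) ^ (r + 1) / (r : ℂ)) •
            (∑ i, (u i - 1) ^ r - ∑ i, (v i - 1) ^ r)).support ∧
        ∀ e' ∈ (∑ r ∈ Finset.Icc 1 R, ((-1 : ℂ) ^ (r + 1) / (r : ℂ)) •
            (∑ i, (u i - 1) ^ r - ∑ i, (v i - 1) ^ r)).support, e' ≠ e →
          w 0 * (e 0 : ℤ) + w 1 * (e 1 : ℤ) < w 0 * (e' 0 : ℤ) + w 1 * (e' 1 : ℤ))}.ncard ≤ 2 * n := by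
  intro n u v hu hv
  choose g hg using hu
  choose g' hg' using hv
  exact ncard_le_of_rays n (fun R => (∑ r ∈ Finset.Icc 1 R, ((-1 : ℂ) ^ (r + 1) / (r : ℂ)) •
      (∑ i, (u i - 1) ^ r - ∑ i, (v i - 1) ^ r)).support) g g'
    (fun R e he => mem_ray_of_mem_support u v g g' hg hg' R e he) _ (fun e he => he)

/-- The same rung on the polynomial side: for ray factors with constant terms `1`, `∏ u − ∏ v` has at most `2n`
south-west vertices (strict minimisers over its support of a linear form with both weights positive), by the
landed power-sum criterion. [folklore] -/
theorem swVert_le_of_rayFactors (n : ℕ) (u v : Fin n → MvPolynomial (Fin 2) ℂ)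
    (hu : ∀ i, ∃ g : Fin 2 →₀ ℕ, ∀ e ∈ (u i).support, ∃ k : ℕ, e = k • g)
    (hv : ∀ i, ∃ g : Fin 2 →₀ ℕ, ∀ e ∈ (v i).support, ∃ k : ℕ, e = k • g)
    (hu0 : ∀ i, coeff 0 (u i) = 1) (hv0 : ∀ i, coeff 0 (v i) = 1) :
    {e : Fin 2 →₀ ℕ | ∃ w : Fin 2 → ℤ, 0 < w 0 ∧ 0 < w 1 ∧ e ∈ (∏ i, u i - ∏ i, v i).support ∧
        ∀ e' ∈ (∏ i, u i - ∏ i, v i).support, e' ≠ e →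
          w 0 * (e 0 : ℤ) + w 1 * (e 1 : ℤ) < w 0 * (e' 0 : ℤ) + w 1 * (e' 1 : ℤ)}.ncard ≤ 2 * n := by
  refine le_trans (le_of_eq ?_) (stub_engineRayFactors n u v hu hv)
  congr 1
  ext e
  simp only [Set.mem_setOf_eq]
  constructor
  · rintro ⟨w, hw0, hw1, h⟩
    exact ⟨w, hw0, hw1, fun R hR =>
      (PowerSum.stub_powerSumCriterion n u v hu0 hv0 w hw0 hw1 e R hR).1 h⟩
  · rintro ⟨w, hw0, hw1, h⟩
    refine ⟨w, hw0, hw1, ?_⟩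
    have hR : w 0 * (e 0 : ℤ) + w 1 * (e 1 : ℤ) < (((w 0 * (e 0 : ℤ) + w 1 * (e 1 : ℤ)).toNat + 1 : ℕ) : ℤ) := by
      have := Int.self_le_toNat (w 0 * (e 0 : ℤ) + w 1 * (e 1 : ℤ))
      push_cast
      omega
    exact (PowerSum.stub_powerSumCriterion n u v hu0 hv0 w hw0 hw1 e _ hR).2 (h _ hR)

end Summit.ValiantsHypothesis.ValiantsHypothesis.Theorems.TwoProducts.RayFactors
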